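import Literature.Analysis.Matrix.CGEuclideanErrorMonotone
import Literature.Analysis.Matrix.CGErrorUpperBound
import Literature.Analysis.Matrix.CGLanczosTridiagonal
import Literature.Analysis.Matrix.LanczosInverseBounds
import HarnessLib

/-!
# The Euclidean norm of the CG iterate from the CG coefficients:
# `‖x_k − x₀‖² = Σ_{j<k} ‖r_j‖⁻² (Σ_{i=j}^{k−1} γ_i‖r_i‖²)²` and Meurant–Tichý's recurrences
# `ϑ_{k+1} = ϑ_k + γ_k φ_k⁻¹`, `ξ_{k+1} = ξ_k + ψ_k(ϑ_{k+1} + ϑ_k)`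

Topic `Analysis/Matrix` — the CG thread (`CGErrorEstimate`: the recursion `cgState`, `cgCoeff = γ_k`;
`CGErrorUpperBound`: `φ_k = ‖r_k‖²/‖p_k‖²`, (eq:phi), (eq:minres) `‖p_k‖² = ‖r_k‖⁴Σ_{j≤k}‖r_j‖⁻²`;
`CGEuclideanErrorMonotone`: `x_k − x₀ = Σ_{i<k} γ_i p_i`; `CGLanczosTridiagonal`: the CG run as a
Lanczos relation `A V = V T + r̃ eᵀ`; `LanczosInverseBounds`: the Lanczos–Galerkin iterate).  PUBLISHED RESULT with the printed proof;
two definitions (the two recursively updated scalars of the source's Lemma 1); no named fact (D-0026).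

HONEST FRAMING: exact (Metropolis-corrected) sampling algorithms for lattice gauge theory; figures
of merit are autocorrelation/cost numbers at stated couplings and volumes; no continuum-physics claim.

## Source (held text) and what is taken

G. Meurant, P. Tichý, *Approximating the extreme Ritz values and upper bounds for the A-norm of the
error in CG*, Numer. Algorithms 82 (2019) 937–968 = arXiv:1810.02127 [MeurantTichy2018], §7
(normwise backward error `η = ‖r̃‖/(‖A‖‖x̃‖ + ‖b‖)` needs `‖x_k‖`), §7.1 "A cheap approximation of
`‖x_k‖` in CG" (held text p. 13): "If `x_0 = 0`, then … `x_k = ‖r_0‖V_kT_k⁻¹e_1` … Using the global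
orthogonality among the Lanczos vectors we obtain `‖x_k‖² = ‖r_0‖²e_1ᵀT_k⁻²e_1`" (eq. `xknorm`);
"**Lemma 1.** … `ξ_k = Σ_{j=0}^{k−1} ‖r_j‖⁻² (Σ_{i=j}^{k−1} ψ_i)²`, `ψ_i = γ_i‖r_i‖²`, and `ξ_{k+1}`
… can be computed using the recurrences `ϑ_{k+1} = ϑ_k + γ_kφ_k⁻¹`, `ξ_{k+1} = ξ_k + ψ_k(ϑ_{k+1} +
ϑ_k)`, where `ϑ_0 = 0`, `ξ_0 = 0`, and `φ_k` can be updated using (eq:phi)"; its proof: "`y_j =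
(−1)^{j+1}‖r_{j−1}‖⁻¹ Σ_{i=j−1}^{k−1} ψ_i`", "`ϑ_k ≡ Σ_{j<k} (Σ_{i=j}^{k−1}ψ_i)/‖r_j‖²`",
"`ϑ_{k+1} = γ_k + ϑ_k + γ_kδ_kφ_{k−1}⁻¹ = ϑ_k + γ_kφ_k⁻¹`; see (eq:phi) and (eq:minres)"; and after
the lemma: "If `x_0 ≠ 0`, then `x_k = x_0 + ‖r_0‖V_kT_k⁻¹e_1` and `ξ_k` can be seen as an
approximation to `‖x_k − x_0‖²`" (exact in exact arithmetic — the source's "approximation" refers to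
the loss of orthogonality in finite precision, which is not modelled here).

## What is formalised (`x_k, r_k, p_k = cgState A b x₀ k`, `γ_k = cgCoeff`, `ψ_i = γ_i‖r_i‖²`;
## `A ≻ 0`; "`r_0, …, r_{k−1} ≠ 0`" where a division by `‖r_j‖²` occurs)

* `cgState_p_eq_sum` — `p_k = Σ_{j≤k} (‖r_k‖²/‖r_j‖²) r_j` (unrolling `p_{k+1} = r_{k+1} + δ_{k+1}p_k`);
* **`cgState_x_sub_eq_sum_residuals`** — `x_k − x₀ = Σ_{j<k} (Σ_{i=j}^{k−1}ψ_i) ‖r_j‖⁻² r_j` (the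
  source's `y_j` in the residual basis `v_j = ±r_j/‖r_j‖`);
* **`normSq_cgState_x_sub`** — `‖x_k − x₀‖² = Σ_{j<k} (Σ_{i=j}^{k−1}ψ_i)²/‖r_j‖²` (Lemma 1's closed
  form IS the squared distance travelled, by the orthogonality of the residuals — eq. `xknorm`'s
  content without the Jacobi matrix);
* defs `cgNormTheta` (`ϑ`), `cgNormXi` (`ξ`) by the printed recurrences (`φ_k⁻¹ = ‖p_k‖²/‖r_k‖²`),
  `cgNormTheta_eq_sum`, **`cgNormXi_eq_sum`** (Lemma 1: the recurrences compute the closed forms) and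
  the headline **`normSq_cgState_x_sub_eq_cgNormXi`**: `‖x_k − x₀‖² = ξ_k` while `r_0, …, r_{k−1} ≠ 0`
  (so for `x₀ = 0`, `‖x_k‖² = ξ_k` — two extra scalars per CG step, no vector norm).

* `cgState_x_sub_eq_basis_mulVec` (`x_{k+1} − x₀ = V_k T_k⁻¹(ρ_0 e_1)` with the tree's
  `cgLanczosBasis` / `cgLanczosMatrix`, by `LanczosInverseBounds.isCGIterate_lanczosGalerkin` and the
  uniqueness of the Galerkin vector), **`normSq_cgState_x_sub_eq_jacobi`** — eq. `xknorm` proper,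
  `‖x_{k+1} − x₀‖² = ρ_0² Σ_j ((T_k⁻¹)_{j1})² = ρ_0² e_1ᵀT_k⁻²e_1`, and `cgNormXi_eq_jacobi`.

NOT formalised: eq. `term` for `x₀ ≠ 0` (the cross term `2‖r_0‖x_0ᵀV_kT_k⁻¹e_1`), the `‖A‖`
estimators of §5 and hence the backward-error ESTIMATE built on (eq:bck) (the Rigal–Gaches formula
(eq:bck) itself is the tree's `Literature/Analysis/Matrix/NormwiseBackwardError.lean`), finite
precision (where `ξ_k` only approximates `‖x_k − x_0‖²`).
-/

noncomputable section

open scoped Matrix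
open Finset

namespace Literature.Analysis.Matrix

namespace ConjugateGradient

open _root_.Matrix

variable {ι : Type*} [Fintype ι] {A : Matrix ι ι ℝ} {b x₀ : ι → ℝ}

/-- `v ≠ 0 ⇒ 0 < vᵀv`. [folklore] -/
private theorem dotProduct_self_pos₉ {v : ι → ℝ} (hv : v ≠ 0) : 0 < v ⬝ᵥ v :=
  lt_of_le_of_ne (Fintype.sum_nonneg fun _ => mul_self_nonneg _)
    fun h => hv (dotProduct_self_eq_zero.mp h.symm)

/-! ### The iterate in the residual basis -/

/-- **`p_k = ‖r_k‖² Σ_{j≤k} r_j/‖r_j‖²`** while `r_0, …, r_k ≠ 0` (unrolling `p_{k+1} = r_{k+1} +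
δ_{k+1}p_k`, `δ_{k+1} = ‖r_{k+1}‖²/‖r_k‖²`, `p_0 = r_0`). [cite: MeurantTichy2018, §2 (CG:
`p_{k+1} = r_{k+1} + δ_{k+1}p_k`) and §7.1 proof of Lemma 1] -/
theorem cgState_p_eq_sum {k : ℕ} (hne : ∀ j ≤ k, (cgState A b x₀ j).r ≠ 0) :
    (cgState A b x₀ k).p = ∑ j ∈ range (k + 1),
      (((cgState A b x₀ k).r ⬝ᵥ (cgState A b x₀ k).r) /
        ((cgState A b x₀ j).r ⬝ᵥ (cgState A b x₀ j).r)) • (cgState A b x₀ j).r := by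
  induction k with
  | zero =>
    have h0 : (cgState A b x₀ 0).r ⬝ᵥ (cgState A b x₀ 0).r ≠ 0 :=
      (dotProduct_self_pos₉ (hne 0 le_rfl)).ne'
    rw [sum_range_one, div_self h0, one_smul]
    rfl
  | succ k ih =>
    have hk : (cgState A b x₀ k).r ⬝ᵥ (cgState A b x₀ k).r ≠ 0 :=
      (dotProduct_self_pos₉ (hne k k.le_succ)).ne'
    have hk1 : (cgState A b x₀ (k + 1)).r ⬝ᵥ (cgState A b x₀ (k + 1)).r ≠ 0 :=
      (dotProduct_self_pos₉ (hne (k + 1) le_rfl)).ne'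
    rw [cgState_succ_p, ih (fun j hj => hne j (hj.trans k.le_succ)), smul_sum, sum_range_succ _ (k + 1),
      div_self hk1, one_smul, add_comm]
    congr 1
    refine sum_congr rfl fun j _ => ?_
    rw [smul_smul]
    congr 1
    field_simp

/-- **`x_k − x₀ = Σ_{j<k} c_j r_j` with `c_j = (Σ_{i=j}^{k−1} γ_i‖r_i‖²)/‖r_j‖²`** while
`r_0, …, r_{k−1} ≠ 0` — the source's `x_k − x_0 = ‖r_0‖V_kT_k⁻¹e_1 = V_k y`,
`y_j = (−1)^{j+1}‖r_{j−1}‖⁻¹Σ_{i=j−1}^{k−1}ψ_i`, written in the residuals `r_j = (−1)^j‖r_j‖v_{j+1}`.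
[cite: MeurantTichy2018, §7.1 proof of Lemma 1] -/
theorem cgState_x_sub_eq_sum_residuals {k : ℕ} (hne : ∀ j < k, (cgState A b x₀ j).r ≠ 0) :
    (cgState A b x₀ k).x - x₀ = ∑ j ∈ range k,
      ((∑ i ∈ Ico j k, cgCoeff A b x₀ i * ((cgState A b x₀ i).r ⬝ᵥ (cgState A b x₀ i).r)) /
        ((cgState A b x₀ j).r ⬝ᵥ (cgState A b x₀ j).r)) • (cgState A b x₀ j).r := by
  rw [cgState_x_sub_eq_sum]
  -- substitute `p_i = Σ_{j≤i} (‖r_i‖²/‖r_j‖²) r_j` and swap the sums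
  have hp : ∀ i ∈ range k, cgCoeff A b x₀ i • (cgState A b x₀ i).p =
      ∑ j ∈ range (i + 1), (cgCoeff A b x₀ i * ((cgState A b x₀ i).r ⬝ᵥ (cgState A b x₀ i).r) /
        ((cgState A b x₀ j).r ⬝ᵥ (cgState A b x₀ j).r)) • (cgState A b x₀ j).r := by
    intro i hi
    rw [cgState_p_eq_sum (fun j hj => hne j (lt_of_le_of_lt hj (mem_range.mp hi))), smul_sum]
    refine sum_congr rfl fun j _ => ?_
    rw [smul_smul, mul_div_assoc]
  rw [sum_congr rfl hp,
    sum_comm' (s := range k) (t := fun i => range (i + 1)) (t' := range k) (s' := fun j => Ico j k)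
      (fun i j => by
        simp only [mem_range, mem_Ico]
        omega)]
  refine sum_congr rfl fun j _ => ?_
  rw [← sum_smul, sum_div]

/-- Pythagoras for the orthogonal residuals, `k`-term form: `‖Σ_{j<k} c_j r_j‖² = Σ_{j<k} c_j²‖r_j‖²`.
[cite: Saad2003, §6.7.1 ("the residual vectors … are orthogonal to each other")] -/
private theorem normSq_sum_smul_r' (hA : A.PosDef) (k : ℕ) (c : ℕ → ℝ) :
    (∑ j ∈ range k, c j • (cgState A b x₀ j).r) ⬝ᵥ (∑ j ∈ range k, c j • (cgState A b x₀ j).r) =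
      ∑ j ∈ range k, c j ^ 2 * ((cgState A b x₀ j).r ⬝ᵥ (cgState A b x₀ j).r) := by
  cases k with
  | zero => simp
  | succ k => exact normSq_sum_smul_r hA b x₀ k c

/-- **`‖x_k − x₀‖² = Σ_{j<k} (Σ_{i=j}^{k−1} γ_i‖r_i‖²)²/‖r_j‖²`** while `r_0, …, r_{k−1} ≠ 0` — the
closed form of the source's Lemma 1 is EXACTLY the squared Euclidean distance from the start
(eq. `xknorm`: "using the global orthogonality among the Lanczos vectors"; here the orthogonality of
the CG residuals). [cite: MeurantTichy2018, §7.1 eq. `xknorm` and Lemma 1] -/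
theorem normSq_cgState_x_sub (hA : A.PosDef) {k : ℕ} (hne : ∀ j < k, (cgState A b x₀ j).r ≠ 0) :
    ((cgState A b x₀ k).x - x₀) ⬝ᵥ ((cgState A b x₀ k).x - x₀) = ∑ j ∈ range k,
      (∑ i ∈ Ico j k, cgCoeff A b x₀ i * ((cgState A b x₀ i).r ⬝ᵥ (cgState A b x₀ i).r)) ^ 2 /
        ((cgState A b x₀ j).r ⬝ᵥ (cgState A b x₀ j).r) := by
  rw [cgState_x_sub_eq_sum_residuals hne, normSq_sum_smul_r' hA]
  refine sum_congr rfl fun j hj => ?_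
  have h := (dotProduct_self_pos₉ (hne j (mem_range.mp hj))).ne'
  field_simp

/-! ### Meurant–Tichý's recurrences (Lemma 1) -/

/-- **`ϑ_k`**: `ϑ_0 = 0`, `ϑ_{k+1} = ϑ_k + γ_kφ_k⁻¹` with `φ_k⁻¹ = ‖p_k‖²/‖r_k‖²`.
[cite: MeurantTichy2018, §7.1 Lemma 1 (first recurrence)] -/
def cgNormTheta (A : Matrix ι ι ℝ) (b x₀ : ι → ℝ) : ℕ → ℝ
  | 0 => 0
  | k + 1 => cgNormTheta A b x₀ k + cgCoeff A b x₀ k *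
      (((cgState A b x₀ k).p ⬝ᵥ (cgState A b x₀ k).p) / ((cgState A b x₀ k).r ⬝ᵥ (cgState A b x₀ k).r))

/-- **`ξ_k`**: `ξ_0 = 0`, `ξ_{k+1} = ξ_k + ψ_k(ϑ_{k+1} + ϑ_k)`, `ψ_k = γ_k‖r_k‖²`.
[cite: MeurantTichy2018, §7.1 Lemma 1 (second recurrence)] -/
def cgNormXi (A : Matrix ι ι ℝ) (b x₀ : ι → ℝ) : ℕ → ℝ
  | 0 => 0
  | k + 1 => cgNormXi A b x₀ k + cgCoeff A b x₀ k * ((cgState A b x₀ k).r ⬝ᵥ (cgState A b x₀ k).r) *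
      (cgNormTheta A b x₀ (k + 1) + cgNormTheta A b x₀ k)

/-- `ϑ_0 = 0`. [cite: MeurantTichy2018, §7.1 Lemma 1] -/
@[simp] theorem cgNormTheta_zero : cgNormTheta A b x₀ 0 = 0 := rfl

/-- `ϑ_{k+1} = ϑ_k + γ_kφ_k⁻¹`. [cite: MeurantTichy2018, §7.1 Lemma 1] -/
theorem cgNormTheta_succ (k : ℕ) : cgNormTheta A b x₀ (k + 1) = cgNormTheta A b x₀ k +
    cgCoeff A b x₀ k * (((cgState A b x₀ k).p ⬝ᵥ (cgState A b x₀ k).p) /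
      ((cgState A b x₀ k).r ⬝ᵥ (cgState A b x₀ k).r)) := rfl

/-- `ξ_0 = 0`. [cite: MeurantTichy2018, §7.1 Lemma 1] -/
@[simp] theorem cgNormXi_zero : cgNormXi A b x₀ 0 = 0 := rfl

/-- `ξ_{k+1} = ξ_k + ψ_k(ϑ_{k+1} + ϑ_k)`. [cite: MeurantTichy2018, §7.1 Lemma 1] -/
theorem cgNormXi_succ (k : ℕ) : cgNormXi A b x₀ (k + 1) = cgNormXi A b x₀ k +
    cgCoeff A b x₀ k * ((cgState A b x₀ k).r ⬝ᵥ (cgState A b x₀ k).r) *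
      (cgNormTheta A b x₀ (k + 1) + cgNormTheta A b x₀ k) := rfl

/-- Shifting the partial sums `S_j^{(k+1)} = S_j^{(k)} + ψ_k` (`j ≤ k`), `S_k^{(k+1)} = ψ_k`:
`Σ_{j≤k} S_j^{(k+1)}/n_j = Σ_{j<k} S_j^{(k)}/n_j + ψ_k Σ_{j<k} n_j⁻¹ + ψ_k/n_k` (`n_j = ‖r_j‖²`). [folklore] -/
private theorem sum_shift_div (k : ℕ) :
    ∑ j ∈ range (k + 1),
        (∑ i ∈ Ico j (k + 1), cgCoeff A b x₀ i * ((cgState A b x₀ i).r ⬝ᵥ (cgState A b x₀ i).r)) /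
          ((cgState A b x₀ j).r ⬝ᵥ (cgState A b x₀ j).r) =
      ∑ j ∈ range k,
          (∑ i ∈ Ico j k, cgCoeff A b x₀ i * ((cgState A b x₀ i).r ⬝ᵥ (cgState A b x₀ i).r)) /
            ((cgState A b x₀ j).r ⬝ᵥ (cgState A b x₀ j).r) +
        cgCoeff A b x₀ k * ((cgState A b x₀ k).r ⬝ᵥ (cgState A b x₀ k).r) *
          ∑ j ∈ range k, ((cgState A b x₀ j).r ⬝ᵥ (cgState A b x₀ j).r)⁻¹ +
        cgCoeff A b x₀ k * ((cgState A b x₀ k).r ⬝ᵥ (cgState A b x₀ k).r) /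
          ((cgState A b x₀ k).r ⬝ᵥ (cgState A b x₀ k).r) := by
  rw [sum_range_succ, Nat.Ico_succ_singleton, sum_singleton,
    sum_congr rfl fun j hj => by rw [Finset.sum_Ico_succ_top (mem_range.mp hj).le, add_div],
    sum_add_distrib, mul_sum]
  congr 2

/-- … and for the squares: `Σ_{j≤k} (S_j^{(k+1)})²/n_j = Σ_{j<k} (S_j^{(k)})²/n_j + 2ψ_k Σ_{j<k} S_j^{(k)}/n_j
+ ψ_k² Σ_{j<k} n_j⁻¹ + ψ_k²/n_k`. [folklore] -/
private theorem sum_shift_sq_div (k : ℕ) :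
    ∑ j ∈ range (k + 1),
        (∑ i ∈ Ico j (k + 1), cgCoeff A b x₀ i * ((cgState A b x₀ i).r ⬝ᵥ (cgState A b x₀ i).r)) ^ 2 /
          ((cgState A b x₀ j).r ⬝ᵥ (cgState A b x₀ j).r) =
      ∑ j ∈ range k,
          (∑ i ∈ Ico j k, cgCoeff A b x₀ i * ((cgState A b x₀ i).r ⬝ᵥ (cgState A b x₀ i).r)) ^ 2 /
            ((cgState A b x₀ j).r ⬝ᵥ (cgState A b x₀ j).r) +
        2 * (cgCoeff A b x₀ k * ((cgState A b x₀ k).r ⬝ᵥ (cgState A b x₀ k).r)) *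
          ∑ j ∈ range k,
            (∑ i ∈ Ico j k, cgCoeff A b x₀ i * ((cgState A b x₀ i).r ⬝ᵥ (cgState A b x₀ i).r)) /
              ((cgState A b x₀ j).r ⬝ᵥ (cgState A b x₀ j).r) +
        (cgCoeff A b x₀ k * ((cgState A b x₀ k).r ⬝ᵥ (cgState A b x₀ k).r)) ^ 2 *
          ∑ j ∈ range k, ((cgState A b x₀ j).r ⬝ᵥ (cgState A b x₀ j).r)⁻¹ +
        (cgCoeff A b x₀ k * ((cgState A b x₀ k).r ⬝ᵥ (cgState A b x₀ k).r)) ^ 2 /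
          ((cgState A b x₀ k).r ⬝ᵥ (cgState A b x₀ k).r) := by
  set ψ := cgCoeff A b x₀ k * ((cgState A b x₀ k).r ⬝ᵥ (cgState A b x₀ k).r) with hψ
  have hexp : ∀ j ∈ range k,
      (∑ i ∈ Ico j (k + 1), cgCoeff A b x₀ i * ((cgState A b x₀ i).r ⬝ᵥ (cgState A b x₀ i).r)) ^ 2 /
          ((cgState A b x₀ j).r ⬝ᵥ (cgState A b x₀ j).r) =
        (∑ i ∈ Ico j k, cgCoeff A b x₀ i * ((cgState A b x₀ i).r ⬝ᵥ (cgState A b x₀ i).r)) ^ 2 /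
            ((cgState A b x₀ j).r ⬝ᵥ (cgState A b x₀ j).r) +
          2 * ψ * ((∑ i ∈ Ico j k, cgCoeff A b x₀ i * ((cgState A b x₀ i).r ⬝ᵥ (cgState A b x₀ i).r)) /
            ((cgState A b x₀ j).r ⬝ᵥ (cgState A b x₀ j).r)) +
          ψ ^ 2 * ((cgState A b x₀ j).r ⬝ᵥ (cgState A b x₀ j).r)⁻¹ := by
    intro j hj
    rw [Finset.sum_Ico_succ_top (mem_range.mp hj).le, ← hψ, div_eq_mul_inv, div_eq_mul_inv,
      div_eq_mul_inv]
    ring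
  rw [sum_range_succ, Nat.Ico_succ_singleton, sum_singleton, ← hψ, sum_congr rfl hexp,
    sum_add_distrib, sum_add_distrib, ← mul_sum, ← mul_sum]

/-- **Lemma 1, first half: `ϑ_k = Σ_{j<k} (Σ_{i=j}^{k−1}ψ_i)/‖r_j‖²`** while `r_0, …, r_{k−1} ≠ 0`
("`ϑ_{k+1} = γ_k + ϑ_k + ψ_kΣ_{j<k}‖r_j‖⁻² = γ_k + ϑ_k + γ_kδ_kφ_{k−1}⁻¹ = ϑ_k + γ_kφ_k⁻¹`; see
(eq:phi) and (eq:minres)" — here through the tree's (eq:minres) `cgState_normSq_p_eq`: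
`φ_k⁻¹ = ‖r_k‖²Σ_{j≤k}‖r_j‖⁻²`). [cite: MeurantTichy2018, §7.1 Lemma 1 (proof, formula for `ϑ_k`)] -/
theorem cgNormTheta_eq_sum (hA : A.PosDef) {k : ℕ} (hne : ∀ j < k, (cgState A b x₀ j).r ≠ 0) :
    cgNormTheta A b x₀ k = ∑ j ∈ range k,
      (∑ i ∈ Ico j k, cgCoeff A b x₀ i * ((cgState A b x₀ i).r ⬝ᵥ (cgState A b x₀ i).r)) /
        ((cgState A b x₀ j).r ⬝ᵥ (cgState A b x₀ j).r) := by
  induction k with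
  | zero => simp
  | succ k ih =>
    have hne' : ∀ j < k, (cgState A b x₀ j).r ≠ 0 := fun j hj => hne j (hj.trans k.lt_succ_self)
    have hrk : (cgState A b x₀ k).r ≠ 0 := hne k k.lt_succ_self
    have hk : (cgState A b x₀ k).r ⬝ᵥ (cgState A b x₀ k).r ≠ 0 := (dotProduct_self_pos₉ hrk).ne'
    have hL : ∑ j ∈ range (k + 1), ((cgState A b x₀ j).r ⬝ᵥ (cgState A b x₀ j).r)⁻¹ =
        ∑ j ∈ range k, ((cgState A b x₀ j).r ⬝ᵥ (cgState A b x₀ j).r)⁻¹ +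
          ((cgState A b x₀ k).r ⬝ᵥ (cgState A b x₀ k).r)⁻¹ := sum_range_succ _ _
    rw [cgNormTheta_succ, ih hne', cgState_normSq_p_eq hA b x₀ hrk, hL, sum_shift_div]
    field_simp
    ring

/-- **Lemma 1, second half: `ξ_k = Σ_{j<k} (Σ_{i=j}^{k−1}ψ_i)²/‖r_j‖²`** while `r_0, …, r_{k−1} ≠ 0`
("`ξ_{k+1} = ψ_k²/‖r_k‖² + Σ_{j<k}ψ_k²/‖r_j‖² + Σ_{j<k}2ψ_kΣ_{i=j}^{k−1}ψ_i/‖r_j‖² + ξ_k = ξ_k +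
ψ_k(ϑ_{k+1} + ϑ_k)`"). [cite: MeurantTichy2018, §7.1 Lemma 1] -/
theorem cgNormXi_eq_sum (hA : A.PosDef) {k : ℕ} (hne : ∀ j < k, (cgState A b x₀ j).r ≠ 0) :
    cgNormXi A b x₀ k = ∑ j ∈ range k,
      (∑ i ∈ Ico j k, cgCoeff A b x₀ i * ((cgState A b x₀ i).r ⬝ᵥ (cgState A b x₀ i).r)) ^ 2 /
        ((cgState A b x₀ j).r ⬝ᵥ (cgState A b x₀ j).r) := by
  induction k with
  | zero => simp
  | succ k ih =>
    have hne' : ∀ j < k, (cgState A b x₀ j).r ≠ 0 := fun j hj => hne j (hj.trans k.lt_succ_self)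
    rw [cgNormXi_succ, ih hne', cgNormTheta_eq_sum hA hne, cgNormTheta_eq_sum hA hne', sum_shift_div,
      sum_shift_sq_div]
    ring

/-- **`‖x_k − x₀‖² = ξ_k`** (for `A ≻ 0` and `r_0, …, r_{k−1} ≠ 0`): the two-scalar recurrence of
Lemma 1 computes the squared Euclidean length of the CG correction exactly (for `x₀ = 0`:
`‖x_k‖² = ξ_k`, the quantity entering the normwise backward error (eq:bck)).
[cite: MeurantTichy2018, §7.1 eq. `xknorm` with Lemma 1] -/
theorem normSq_cgState_x_sub_eq_cgNormXi (hA : A.PosDef) {k : ℕ}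
    (hne : ∀ j < k, (cgState A b x₀ j).r ≠ 0) :
    ((cgState A b x₀ k).x - x₀) ⬝ᵥ ((cgState A b x₀ k).x - x₀) = cgNormXi A b x₀ k := by
  rw [normSq_cgState_x_sub hA hne, cgNormXi_eq_sum hA hne]

/-! ### The Jacobi-matrix form (eq. `xknorm`): `‖x_k − x₀‖² = ‖r_0‖² e_1ᵀ T_k⁻² e_1` -/

section Jacobi

variable [DecidableEq ι]

open Literature.Analysis.Matrix.LanczosGauss

/-- **`x_k − x_0 = ‖r_0‖ V_k T_k⁻¹ e_1`** (here after `k + 1` steps, with the tree's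
`V = cgLanczosBasis A b x₀ k`, `T = cgLanczosMatrix A b x₀ k` on `Fin (k+1)`): the CG iterate is the
Lanczos–Galerkin iterate (`LanczosInverseBounds.isCGIterate_lanczosGalerkin` + uniqueness of the
Galerkin vector). [cite: MeurantTichy2018, §7.1 (first display and "If `x_0 ≠ 0`, then `x_k = x_0 +
‖r_0‖V_kT_k⁻¹e_1`")] [cite: GolubMeurant2010, §12.2 proof of Thm 12.1 ("`x^k = x⁰ + V_k y^k`")] -/
theorem cgState_x_sub_eq_basis_mulVec (hA : A.PosDef) {k : ℕ}
    (hne : ∀ j ≤ k, (cgState A b x₀ j).r ≠ 0) :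
    (cgState A b x₀ (k + 1)).x - x₀ = cgLanczosBasis A b x₀ k *ᵥ
      ((cgLanczosMatrix A b x₀ k)⁻¹ *ᵥ (cgResNorm A b x₀ 0 • Pi.single 0 1)) := by
  have hL := cgLanczosRelation hA hne
  have h0 : (cgState A b x₀ 0).r ≠ 0 := hne 0 (Nat.zero_le _)
  have hρ : cgResNorm A b x₀ 0 ≠ 0 := (cgResNorm_pos b x₀ A h0).ne'
  have hr := cgLanczosBasis_col_zero (k := k) h0
  have hG := hL.isCGIterate_lanczosGalerkin hA (cgLanczosMatrix_subdiag_ne_zero hA hne) b x₀ hρ hr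
  have hx := (isCGIterate_cgState hA b x₀ (k + 1)).unique hA hG
  have hV0 : (cgLanczosBasis A b x₀ k)ᴴ *ᵥ (b - A *ᵥ x₀) = cgResNorm A b x₀ 0 • Pi.single 0 1 := by
    rw [hr, mulVec_smul, ← mulVec_single_one, mulVec_mulVec, hL.isometry, one_mulVec]
  rw [hx, add_sub_cancel_left, hL.compression, hV0]

/-- **Eq. `xknorm`: `‖x_k − x_0‖² = ‖r_0‖² e_1ᵀ T_k⁻² e_1`** ("using the global orthogonality among
the Lanczos vectors"), written as `‖r_0‖² Σ_j ((T_k⁻¹)_{j,1})²`; for `A ≻ 0` and `r_0, …, r_k ≠ 0`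
(`k + 1` steps). [cite: MeurantTichy2018, §7.1 eq. `xknorm`] -/
theorem normSq_cgState_x_sub_eq_jacobi (hA : A.PosDef) {k : ℕ}
    (hne : ∀ j ≤ k, (cgState A b x₀ j).r ≠ 0) :
    ((cgState A b x₀ (k + 1)).x - x₀) ⬝ᵥ ((cgState A b x₀ (k + 1)).x - x₀) =
      cgResNorm A b x₀ 0 ^ 2 * ∑ j, ((cgLanczosMatrix A b x₀ k)⁻¹ j 0) ^ 2 := by
  have hL := cgLanczosRelation hA hne
  have hVtV : (cgLanczosBasis A b x₀ k)ᵀ * cgLanczosBasis A b x₀ k = 1 := by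
    have h := hL.isometry
    rwa [conjTranspose_eq_transpose_of_trivial] at h
  set y := (cgLanczosMatrix A b x₀ k)⁻¹ *ᵥ (cgResNorm A b x₀ 0 • Pi.single 0 1) with hy
  rw [cgState_x_sub_eq_basis_mulVec hA hne, ← hy, dotProduct_mulVec, ← mulVec_transpose,
    mulVec_mulVec, hVtV, one_mulVec, hy, mulVec_smul, mulVec_single_one, dotProduct, mul_sum]
  refine sum_congr rfl fun j _ => ?_
  simp only [Pi.smul_apply, Matrix.col_apply, smul_eq_mul]
  ring

/-- Hence `ξ_{k+1} = ‖r_0‖² e_1ᵀ T_k⁻² e_1`: the recursively computed `ξ` IS the printed quadratic form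
of the Jacobi matrix. [cite: MeurantTichy2018, §7.1 eq. `xknorm` with Lemma 1] -/
theorem cgNormXi_eq_jacobi (hA : A.PosDef) {k : ℕ} (hne : ∀ j ≤ k, (cgState A b x₀ j).r ≠ 0) :
    cgNormXi A b x₀ (k + 1) = cgResNorm A b x₀ 0 ^ 2 * ∑ j, ((cgLanczosMatrix A b x₀ k)⁻¹ j 0) ^ 2 := by
  rw [← normSq_cgState_x_sub_eq_jacobi hA hne,
    normSq_cgState_x_sub_eq_cgNormXi hA fun j hj => hne j (Nat.lt_succ_iff.mp hj)]

end Jacobi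

end ConjugateGradient

end Literature.Analysis.Matrix
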